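import Mathlib
import HarnessLib
import Summits.Schanuel.Schanuel.Theses.PolarPhantoms
import Literature.NumberTheory.Transcendental.RoyCriterion
import Literature.NumberTheory.Transcendental.RoyCriterionProofs
import Literature.NumberTheory.Transcendental.AxSchanuel

/-!
# Sketch — crux-ideate `stmt-Schanuel-6847` (`PolarPhantoms.CheapCertificates`), ideator 2, round 1

First lemmas of the three idea cards (statements only; proofs are `sorry` — they must elaborate,
not be proved, at this stage):

* card `conjugate-relocation`: `certificate_transfer`, `exactAt_transfer`,
  `exists_nonTorsion_conjugate` (Ax–Schanuel + Hermite–Lindemann + Baire), `cheap_of_relocated`.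
* card `fake-jet-small-values`: `cost_lt_iff_fakeValuation` (LP duality, the dual form of
  the crux) and `fakeValuation_kShift` (fake valuations commute with Roy's derivation index).
* card `idempotent-ladder`: `represents_mul` (submultiplicativity of universal certificates on the
  cyclic algebra `ℚ[T]/∏(T-b)^{D₀+1}`), `value_of_represents`, `represents_shift` (the k-shift
  ladder), `certificate_of_idempotents`, `idempotent_cost_exp_lower` (Jensen at exponential points)
  and `ladder_certificate`.
-/

noncomputable section

set_option linter.dupNamespace false

open scoped BigOperators
open Literature.NumberTheory.Transcendental

namespace Summit.Schanuel.Schanuel.Cruxes.CheapCertificates.Sketch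

/-! ### Common vocabulary (inlined exactly as in the route file) -/

/-- Roy's box point `(m·y, α^m) ∈ ℂ × ℂˣ`. -/
def boxPoint {n : ℕ} (y α : Fin n → ℂ) (m : Fin n → ℕ) : Fin 2 → ℂ :=
  ![∑ j, ((m j : ℕ) : ℂ) * y j, ∏ j, α j ^ (m j)]

/-- The box value `L_{k,m}(P) = (D^k P)(m·y, α^m)`. -/
def boxValue {n : ℕ} (y α : Fin n → ℂ) (P : MvPolynomial (Fin 2) ℤ) (k : ℕ) (m : Fin n → ℕ) : ℂ :=
  MvPolynomial.aeval (boxPoint y α m) (royD^[k] P)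

/-- The `k`-range and `m`-box of level `N`. -/
def kRange (s₀ : ℝ) (N : ℕ) : Finset ℕ := Finset.range (⌊(N : ℝ) ^ s₀⌋₊ + 1)
def mBox (n : ℕ) (s₁ : ℝ) (N : ℕ) : Finset (Fin n → ℕ) :=
  Fintype.piFinset fun _ : Fin n => Finset.range (⌊(N : ℝ) ^ s₁⌋₊ + 1)

/-- `c` is a rational certificate for `P` at `(y, α)`, level `N`, with integer value `z`. -/
def IsCertificate {n : ℕ} (y α : Fin n → ℂ) (s₀ s₁ : ℝ) (N : ℕ) (P : MvPolynomial (Fin 2) ℤ)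
    (c : ℕ → (Fin n → ℕ) → ℚ) (z : ℤ) : Prop :=
  (∑ k ∈ kRange s₀ N, ∑ m ∈ mBox n s₁ N, (c k m : ℂ) * boxValue y α P k m) = (z : ℂ)

/-- The ℓ¹-cost of a certificate on the box of level `N`. -/
def cost {n : ℕ} (s₀ s₁ : ℝ) (N : ℕ) (c : ℕ → (Fin n → ℕ) → ℚ) : ℝ :=
  ∑ k ∈ kRange s₀ N, ∑ m ∈ mBox n s₁ N, |(c k m : ℝ)|

/-- In Roy's degree/height box of level `N`. -/
def InBox (t₀ t₁ : ℝ) (N : ℕ) (P : MvPolynomial (Fin 2) ℤ) : Prop :=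
  P ≠ 0 ∧ (P.degreeOf 0 : ℝ) ≤ (N : ℝ) ^ t₀ ∧ (P.degreeOf 1 : ℝ) ≤ (N : ℝ) ^ t₁ ∧
    (mvPolyHeight P : ℝ) ≤ Real.exp (N : ℝ)

/-- Cheap certificates at level `N`: the conclusion of the crux at one `N`. -/
def CheapAt {n : ℕ} (y α : Fin n → ℂ) (s₀ s₁ t₀ t₁ u : ℝ) (N : ℕ) : Prop :=
  ∀ P, InBox t₀ t₁ N P → ∃ c : ℕ → (Fin n → ℕ) → ℚ, cost s₀ s₁ N c < Real.exp ((N : ℝ) ^ u) ∧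
    ∃ z : ℤ, z ≠ 0 ∧ IsCertificate y α s₀ s₁ N P c z

/-- Exactness of the phantom system at level `N` (the antecedent of the crux at one `N`). -/
def ExactAt {n : ℕ} (y α : Fin n → ℂ) (s₀ s₁ t₀ t₁ : ℝ) (N : ℕ) : Prop :=
  ∀ θ : ℕ → ℕ → (ℂ →ₗ[ℚ] ℚ),
    (∀ (k : ℕ) (m : Fin n → ℕ), (k : ℝ) ≤ (N : ℝ) ^ s₀ → (∀ j, (m j : ℝ) ≤ (N : ℝ) ^ s₁) →
      (∑ a ∈ Finset.range (⌊(N : ℝ) ^ t₀⌋₊ + 1), ∑ b ∈ Finset.range (⌊(N : ℝ) ^ t₁⌋₊ + 1),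
        θ a b (boxValue y α (MvPolynomial.X 0 ^ a * MvPolynomial.X 1 ^ b) k m)) = 0) →
    ∀ a b : ℕ, (a : ℝ) ≤ (N : ℝ) ^ t₀ → (b : ℝ) ≤ (N : ℝ) ^ t₁ → θ a b 1 = 0

/-! ### Card `conjugate-relocation` -/

/-- **Transfer (trivial).** A field automorphism — indeed any ring endomorphism — of `ℂ` carries a
certificate to a certificate of the same polynomial, with the same coefficients, value and cost,
at the conjugate point. (`σ` fixes `ℚ` and commutes with `aeval` of integer polynomials.) -/
theorem certificate_transfer (σ : ℂ →+* ℂ) {n : ℕ} (y α : Fin n → ℂ) (s₀ s₁ : ℝ) (N : ℕ)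
    (P : MvPolynomial (Fin 2) ℤ) (c : ℕ → (Fin n → ℕ) → ℚ) (z : ℤ)
    (h : IsCertificate y α s₀ s₁ N P c z) :
    IsCertificate (σ ∘ y) (σ ∘ α) s₀ s₁ N P c z := by
  sorry

/-- **Transfer of exactness.** For a ring automorphism `σ` of `ℂ`, exactness of the phantom
system is invariant (`θ ↦ θ ∘ σ⁻¹`, a `ℚ`-linear map since `σ` fixes `ℚ`). -/
theorem exactAt_transfer (σ : ℂ ≃+* ℂ) {n : ℕ} (y α : Fin n → ℂ) (s₀ s₁ t₀ t₁ : ℝ) (N : ℕ)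
    (h : ExactAt y α s₀ s₁ t₀ t₁ N) : ExactAt (σ ∘ y) (σ ∘ α) s₀ s₁ t₀ t₁ N := by
  sorry

/-- **Relocation lemma (Ax–Schanuel + Hermite–Lindemann + Baire).** A hypothetical Schanuel
counterexample has a NON-exponential conjugate: if `y` is `ℚ`-linearly independent and
`trdeg ℚ(y, e^y) < n`, some automorphism `σ` of `ℂ` moves `(y, e^y)` to a point at which, in some
coordinate `j`, `σ(e^{y_j}) · e^{-σ(y_j)}` is not a root of unity (Roy's condition (a) fails), so
that Roy's Theorem 1 / Proposition 3 apply there. Proof sketch: otherwise every generic point of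
the `ℚ`-locus `V` of `(y, e^y)` is exponential-torsion; by Baire an open piece of `V(ℂ)` lies in a
graph `α = ζ e^{y}`; Ax's theorem (`ax_schanuel_holds`) on that piece gives `dim V ≥ n` unless a
nonzero rational combination of the `y_j` is constant on it, in which case that constant `c` and
`e^c` are both algebraic, contradicting Hermite–Lindemann (`transcendental_exp_holds`). -/
theorem exists_nonTorsion_conjugate {n : ℕ} (y : Fin n → ℂ) (hy : LinearIndependent ℚ y)
    (hlt : Algebra.trdeg ℚ
      ↥(IntermediateField.adjoin ℚ (Set.range y ∪ Set.range (Complex.exp ∘ y))) < (n : Cardinal)) :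
    ∃ σ : ℂ ≃+* ℂ, ∃ j : Fin n, ¬ RoyConditionA (σ (y j)) (σ (Complex.exp (y j))) := by
  sorry

/-- **The relocated crux `D♮` (= the crux restricted to points with a non-torsion direction).**
Stated here only to fix its shape; it is the same implication as `CheapCertificates`, under the
extra hypothesis `∃ j, ¬ RoyConditionA (y j) (α j)`. -/
def CheapCertificatesNonTorsion : Prop :=
  ∀ (n : ℕ) (y α : Fin n → ℂ), LinearIndependent ℚ y → (∀ j, α j ≠ 0) →
    (∃ j, ¬ RoyConditionA (y j) (α j)) →
    Algebra.trdeg ℚ ↥(IntermediateField.adjoin ℚ (Set.range y ∪ Set.range α)) < (n : Cardinal) →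
    (∃ s₀ s₁ t₀ t₁ u : ℝ, RoyAdmissible s₀ s₁ t₀ t₁ u ∧
      ∀ᶠ N : ℕ in Filter.atTop, ExactAt y α s₀ s₁ t₀ t₁ N) →
    ∃ s₀ s₁ t₀ t₁ u : ℝ, RoyAdmissible s₀ s₁ t₀ t₁ u ∧
      ∃ᶠ N : ℕ in Filter.atTop, CheapAt y α s₀ s₁ t₀ t₁ u N

/-- **Assembly of the card** (pure logic + transfer + relocation + the route's `PolarGlue`,
extended by a fixed dilation `X₁ ↦ X₁^d` to torsion-twisted exponential points):
`D♮ → PolarGlue → CheapCertificates`. -/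
theorem cheapCertificates_of_nonTorsion (hD : CheapCertificatesNonTorsion)
    (hG : Summit.Schanuel.Schanuel.Theses.PolarPhantoms.PolarGlue) :
    Summit.Schanuel.Schanuel.Theses.PolarPhantoms.CheapCertificates := by
  sorry

/-! ### Card `fake-jet-small-values` -/

/-- A normalized **fake valuation** of level `N`: a `ℚ`-linear functional `ℂ → ℝ` with `λ 1 = 1`.
(Only its restriction to the finite-dimensional `ℚ`-span of the box values matters.) -/
def IsFakeValuation (lam : ℂ →ₗ[ℚ] ℝ) : Prop := lam 1 = 1

/-- **LP duality (the dual form of the crux).** A certificate of cost `< B` with a nonzero integer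
value exists for `P` iff every normalized fake valuation sees some box value of `P` of size
`> 1/B`. (`→` is the triangle inequality; `←` is finite-dimensional LP duality / Hahn–Banach over
`ℚ`-structures: the `ℚ`-span of the box values is finite-dimensional.) -/
theorem cost_lt_iff_fakeValuation {n : ℕ} (y α : Fin n → ℂ) (s₀ s₁ : ℝ) (N : ℕ)
    (P : MvPolynomial (Fin 2) ℤ) (B : ℝ) (hB : 0 < B) :
    (∃ c : ℕ → (Fin n → ℕ) → ℚ, cost s₀ s₁ N c < B ∧ ∃ z : ℤ, z ≠ 0 ∧ IsCertificate y α s₀ s₁ N P c z)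
      ↔ ∀ lam : ℂ →ₗ[ℚ] ℝ, IsFakeValuation lam →
          ∃ k ∈ kRange s₀ N, ∃ m ∈ mBox n s₁ N, 1 / B < |lam (boxValue y α P k m)| := by
  sorry

/-- **Fake valuations commute with the `k`-shift.** Applying Roy's derivation is `ℤ`-linear on the
polynomial, so a fake valuation of the `(k+1)`-st box value of `P` is the fake valuation of the
`k`-th box value of `D P`: the `k`-direction of the box is "honest" for every fake valuation; only
the `m`-shifts (multiplication by the transcendental `σ_j`) are broken. -/
theorem fakeValuation_kShift {n : ℕ} (y α : Fin n → ℂ) (lam : ℂ →ₗ[ℚ] ℝ)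
    (P : MvPolynomial (Fin 2) ℤ) (k : ℕ) (m : Fin n → ℕ) :
    lam (boxValue y α P (k + 1) m) = lam (boxValue y α (royD P) k m) := by
  sorry


/-! ### Card `fake-jet-small-values` — the α-algebraic one-point reduction -/

/-- The one-point **fake-jet polynomials** at a box point with RATIONAL second coordinate `a = α^m`:
`Φ_k(Y) = (D^k P)(Y, a) ∈ ℚ[Y]_{≤ D₀}` (`X₀ ↦ Y`, `X₁ ↦ a`). At `Y = m·y` they are the box values. -/
def fakeJetPoly (a : ℚ) (P : MvPolynomial (Fin 2) ℤ) (k : ℕ) : Polynomial ℚ :=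
  MvPolynomial.aeval (fun i : Fin 2 => if i = 0 then Polynomial.X else Polynomial.C a) (royD^[k] P)

/-- **One-point reduction (α ∈ ℚⁿ).** If at a single box point `m` the fake-jet polynomials
`Φ_0, …, Φ_K` combine ℓ¹-cheaply to the constant polynomial `1` (an identity in `ℚ[Y]`, no
transcendental involved), then cheap certificates exist at `(y, α)` for every `y` (evaluate the
identity at `Y = m·y`; the value is the integer `1`). Single-`m` identities exist generically as
soon as `K > D₀` (`s₀ > t₀`, always admissible); the crux at α-rational points is their COST. -/
theorem cheapAt_of_onePoint {n : ℕ} (y : Fin n → ℂ) (αq : Fin n → ℚ) (s₀ s₁ t₀ t₁ u : ℝ) (N : ℕ)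
    (m : Fin n → ℕ) (hm : m ∈ mBox n s₁ N)
    (h : ∀ P, InBox t₀ t₁ N P → ∃ c : ℕ → ℚ,
        (∑ k ∈ kRange s₀ N, |(c k : ℝ)|) < Real.exp ((N : ℝ) ^ u) ∧
        (∑ k ∈ kRange s₀ N, Polynomial.C (c k) * fakeJetPoly (∏ j, αq j ^ (m j)) P k) = 1) :
    CheapAt y (fun j => ((αq j : ℚ) : ℂ)) s₀ s₁ t₀ t₁ u N := by
  sorry

/-- **Fake-jet small value estimate at one point** (the dual form, by `cost_lt_iff_fakeValuation`
restricted to `ℚ[Y]_{≤D₀}`): every normalized `ℚ`-linear functional on `ℚ[Y]` — a "quadrature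
rule" with `≤ D₀+1` complex nodes — sees one of `Φ_0, …, Φ_K` at size `> ε`. Roy's 2013 small value
estimate (`roy2013_thm_1_1_holds`) is the case of the rule "evaluate at one point `(ξ, η)`" along a
sequence of levels; the bet of the card is the several-node, one-level version. -/
def FakeJetSmallValues (a : ℚ) (P : MvPolynomial (Fin 2) ℤ) (K : ℕ) (ε : ℝ) : Prop :=
  ∀ lam : Polynomial ℚ →ₗ[ℚ] ℝ, lam 1 = 1 → ∃ k ≤ K, ε < |lam (fakeJetPoly a P k)|

/-- **Rung 1 target family** (exp-free, trdeg 1, uniformly far from exponential-torsion points):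
`y = (φ_1(t), …, φ_n(t))` on a rational polynomial curve, `α ∈ (ℚˣ)ⁿ`, `t` transcendental,
`n ≥ 2`: the crux for this family (first instance beyond trdeg 0). -/
def CheapCertificatesPolyCurve : Prop :=
  ∀ (n : ℕ) (φ : Fin n → Polynomial ℚ) (t : ℂ) (αq : Fin n → ℚ), 2 ≤ n → Transcendental ℚ t →
    LinearIndependent ℚ (fun j => Polynomial.aeval t (φ j)) → (∀ j, αq j ≠ 0) →
    (∃ s₀ s₁ t₀ t₁ u : ℝ, RoyAdmissible s₀ s₁ t₀ t₁ u ∧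
      ∀ᶠ N : ℕ in Filter.atTop,
        ExactAt (fun j => Polynomial.aeval t (φ j)) (fun j => ((αq j : ℚ) : ℂ)) s₀ s₁ t₀ t₁ N) →
    ∃ s₀ s₁ t₀ t₁ u : ℝ, RoyAdmissible s₀ s₁ t₀ t₁ u ∧
      ∃ᶠ N : ℕ in Filter.atTop,
        CheapAt (fun j => Polynomial.aeval t (φ j)) (fun j => ((αq j : ℚ) : ℂ)) s₀ s₁ t₀ t₁ u N

/-! ### Card `idempotent-ladder` (universal certificates: k-shift ladder to frequency projectors + twisted Jensen) -/

/-- The Hermite jet vector of a rational polynomial `g(T)`: `(g^{(a)}(b))_{a ≤ D₀, b ≤ D₁}` — its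
class in the cyclic algebra `𝒜_N = ℚ[T]/∏_{b ≤ D₁}(T-b)^{D₀+1}`. -/
def jet (g : Polynomial ℚ) (a b : ℕ) : ℚ :=
  (Polynomial.derivative^[a] g).eval (b : ℚ)

/-- `c` (finitely supported on `S`) **represents** the polynomial `g` universally at `(y, α)` for the
degree box `(D₀, D₁)`: `∑ c_{k,m} (D^k X₀^a X₁^b)(m·y, α^m) = g^{(a)}(b)` for all `a ≤ D₀, b ≤ D₁`
(i.e. `∑ c_{k,m} T^k σ^m = g` in `𝒜_N ⊗ ℚ(y,α)`). -/
def Represents {n : ℕ} (y α : Fin n → ℂ) (D₀ D₁ : ℕ) (S : Finset (ℕ × (Fin n → ℕ)))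
    (c : ℕ × (Fin n → ℕ) → ℚ) (g : Polynomial ℚ) : Prop :=
  ∀ a ≤ D₀, ∀ b ≤ D₁,
    (∑ km ∈ S, (c km : ℂ) * boxValue y α (MvPolynomial.X 0 ^ a * MvPolynomial.X 1 ^ b) km.1 km.2)
      = ((jet g a b : ℚ) : ℂ)

/-- Convolution of two finitely supported coefficient arrays on `ℕ × ℕⁿ` (Minkowski sum of supports). -/
def conv {n : ℕ} (S S' : Finset (ℕ × (Fin n → ℕ))) (c c' : ℕ × (Fin n → ℕ) → ℚ) :
    ℕ × (Fin n → ℕ) → ℚ :=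
  fun km => ∑ p ∈ S, ∑ q ∈ S', if p.1 + q.1 = km.1 ∧ p.2 + q.2 = km.2 then c p * c' q else 0

/-- **Submultiplicativity of universal certificates.** If `c` represents `g` on `S` and `c'`
represents `g'` on `S'`, then `conv c c'` represents `g * g'` on the Minkowski sum `S + S'`
(because `T^k σ^m · T^{k'} σ^{m'} = T^{k+k'} σ^{m+m'}` in the commutative algebra `𝒜_N ⊗ ℚ(y,α)`,
and Hermite jets of degree `≤ D₀` at `b ≤ D₁` determine the class modulo `∏(T-b)^{D₀+1}`);
its ℓ¹-norm is at most the product of the ℓ¹-norms. -/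
theorem represents_mul {n : ℕ} (y α : Fin n → ℂ) (D₀ D₁ : ℕ)
    (S S' : Finset (ℕ × (Fin n → ℕ))) (c c' : ℕ × (Fin n → ℕ) → ℚ) (g g' : Polynomial ℚ)
    (hc : Represents y α D₀ D₁ S c g) (hc' : Represents y α D₀ D₁ S' c' g') :
    Represents y α D₀ D₁ (Finset.image₂ (fun p q => (p.1 + q.1, p.2 + q.2)) S S') (conv S S' c c')
      (g * g') ∧
    (∑ km ∈ Finset.image₂ (fun p q => (p.1 + q.1, p.2 + q.2)) S S', |(conv S S' c c' km : ℝ)|)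
      ≤ (∑ p ∈ S, |(c p : ℝ)|) * (∑ q ∈ S', |(c' q : ℝ)|) := by
  sorry

/-- **Value of a universal certificate on `P`.** If `c` represents `g`, then pairing with any
integer `P = ∑ p_{ab} X₀^a X₁^b` of bidegree `≤ (D₀, D₁)` gives the RATIONAL number
`∑_{a,b} p_{ab} g^{(a)}(b)`; for `g = T^E` this is `f_P^{(E)}(0) ∈ ℤ`, `f_P(z) = P(z, e^z)`. -/
theorem value_of_represents {n : ℕ} (y α : Fin n → ℂ) (D₀ D₁ : ℕ)
    (S : Finset (ℕ × (Fin n → ℕ))) (c : ℕ × (Fin n → ℕ) → ℚ) (g : Polynomial ℚ)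
    (hc : Represents y α D₀ D₁ S c g) (P : MvPolynomial (Fin 2) ℤ)
    (hP₀ : P.degreeOf 0 ≤ D₀) (hP₁ : P.degreeOf 1 ≤ D₁) :
    (∑ km ∈ S, (c km : ℂ) * boxValue y α P km.1 km.2)
      = ((∑ a ∈ Finset.range (D₀ + 1), ∑ b ∈ Finset.range (D₁ + 1),
            ((P.coeff (Finsupp.single (0 : Fin 2) a + Finsupp.single (1 : Fin 2) b) : ℤ) : ℚ) * jet g a b : ℚ) : ℂ) := by
  sorry

/-- **The k-shift ladder (free).** If `c` represents `g` on `S`, then the array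
`km ↦ c(k-1, m) − b·c(k, m)` represents `(T − b)·g` on `S ∪ (S + (1,0))`, with ℓ¹-norm
`≤ (1 + b)·‖c‖₁`: multiplication by `T` is the k-shift (`T·T^kσ^m = T^{k+1}σ^m`). Iterating,
the Hermite element with jet `a!·e_{(a,b)}` — the universal extractor of `a!·p_{ab}` — costs at most
`(1+b)^a` times the frequency projector `ε_b` (jet `e_{(0,b)}`), using `a` extra units of `k`. -/
theorem represents_shift {n : ℕ} (y α : Fin n → ℂ) (D₀ D₁ : ℕ) (S : Finset (ℕ × (Fin n → ℕ)))
    (c : ℕ × (Fin n → ℕ) → ℚ) (g : Polynomial ℚ) (b : ℕ) (hc : Represents y α D₀ D₁ S c g) :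
    ∃ c' : ℕ × (Fin n → ℕ) → ℚ,
      Represents y α D₀ D₁ (S ∪ S.image (fun km => (km.1 + 1, km.2))) c'
        ((Polynomial.X - Polynomial.C (b : ℚ)) * g) ∧
      (∑ km ∈ S ∪ S.image (fun km => (km.1 + 1, km.2)), |(c' km : ℝ)|)
        ≤ (1 + b) * ∑ km ∈ S, |(c km : ℝ)| := by
  sorry

/-- **Reduction of the crux to cheap frequency projectors (P-free).** If every idempotent
`ε_b` (`b ≤ D₁`; jet `e_{(0,b)}`) is represented on the sub-box `k ≤ K₀`, `m_j ≤ M₀` with cost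
`≤ C`, then every nonzero integer `P` of bidegree `≤ (D₀, D₁)` has a rational certificate on the box
`k ≤ K₀ + D₀`, `m_j ≤ M₀` whose value is the nonzero integer `a!·p_{ab}` for some
`(a,b) ∈ supp P`, of cost `≤ (D₁+1)^{D₀}·C`. -/
theorem certificate_of_idempotents {n : ℕ} (y α : Fin n → ℂ) (D₀ D₁ K₀ M₀ : ℕ) (C : ℝ)
    (hrep : ∀ b ≤ D₁, ∃ (S : Finset (ℕ × (Fin n → ℕ))) (c : ℕ × (Fin n → ℕ) → ℚ) (g : Polynomial ℚ),
      (∀ km ∈ S, km.1 ≤ K₀ ∧ ∀ j, km.2 j ≤ M₀) ∧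
      (∀ a ≤ D₀, ∀ b' ≤ D₁, jet g a b' = if a = 0 ∧ b' = b then 1 else 0) ∧
      Represents y α D₀ D₁ S c g ∧ (∑ km ∈ S, |(c km : ℝ)|) ≤ C)
    (P : MvPolynomial (Fin 2) ℤ) (hP : P ≠ 0) (hP₀ : P.degreeOf 0 ≤ D₀) (hP₁ : P.degreeOf 1 ≤ D₁) :
    ∃ (S : Finset (ℕ × (Fin n → ℕ))) (c : ℕ × (Fin n → ℕ) → ℚ) (z : ℤ), z ≠ 0 ∧
      (∀ km ∈ S, km.1 ≤ K₀ + D₀ ∧ ∀ j, km.2 j ≤ M₀) ∧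
      (∑ km ∈ S, (c km : ℂ) * boxValue y α P km.1 km.2) = (z : ℂ) ∧
      (∑ km ∈ S, |(c km : ℝ)|) ≤ ((D₁ : ℝ) + 1) ^ D₀ * C := by
  sorry

/-- **Twisted Jensen, untwisted case (rigorous anchor): at an exponential point the frequency
projectors are exponentially expensive.** If `α = exp ∘ y`, every (even complex-valued would do;
here rational) representation of the idempotent `ε_{b₀}` on a box `k ≤ K`, `m_j ≤ M_b` has
ℓ¹-cost `≥ 2^{D₁(D₀+1)} / ((5D₁+1)^K · e^{4(D₁+1) M_b Σ‖y_j‖})`: the single dual exponential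
polynomial `Ψ_c(T) = Σ c_{k,m} T^k e^{(m·y)T}` equals `1` at `T = b₀` and vanishes to order
`D₀+1` at the `D₁` other nodes, and Jensen's formula on `|T − b₀| ≤ 2D₁` bounds its growth from
below. (At a non-torsion point the `D₁+1` nodes belong to `D₁+1` DIFFERENT twisted functions
`Ψ^{[b']}`, each carrying only `D₀+1` conditions: no Jensen obstruction.) -/
theorem idempotent_cost_exp_lower {n : ℕ} (y : Fin n → ℂ) (D₀ D₁ K Mb b₀ : ℕ) (hb₀ : b₀ ≤ D₁)
    (S : Finset (ℕ × (Fin n → ℕ))) (hS : ∀ km ∈ S, km.1 ≤ K ∧ ∀ j, km.2 j ≤ Mb)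
    (c : ℕ × (Fin n → ℕ) → ℚ) (g : Polynomial ℚ)
    (hg : ∀ a ≤ D₀, ∀ b ≤ D₁, jet g a b = if a = 0 ∧ b = b₀ then 1 else 0)
    (hc : Represents y (Complex.exp ∘ y) D₀ D₁ S c g) :
    (2 : ℝ) ^ (D₁ * (D₀ + 1)) ≤
      (∑ km ∈ S, |(c km : ℝ)|) * ((5 * D₁ + 1 : ℝ)) ^ K *
        Real.exp (4 * ((D₁ : ℝ) + 1) * Mb * ∑ j, ‖y j‖) := by
  sorry

/-- **The binary ladder with pure powers (valid but NOT the right rungs — kept for the record: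
the jets of `T^E`, `E ~ d`, have size `D₁^E ≫ e^{N^u}·H`, so `T^E` can never be represented
cheaply; the card uses the idempotents `ε_b` and `certificate_of_idempotents` instead).**
If the `I+1` pure powers `T^{2^i (K₀+1)}` (`i ≤ I`, `2^{I+1}(K₀+1) ≥ d`) are
represented on the sub-box `k ≤ K₀, m_j ≤ M₀` with costs `≤ C`, then EVERY nonzero integer `P` of
bidegree `≤ (D₀, D₁)` has a certificate with a nonzero INTEGER value on the box
`k ≤ (I+2) K₀, m_j ≤ (I+1) M₀`, of cost `≤ C^{I+1}`: take `E = ord_{z=0} P(z, e^z) < d`, write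
`E = r + ∑_{i ∈ S} 2^i (K₀+1)` with `r ≤ K₀`, and multiply the representations. -/
theorem ladder_certificate {n : ℕ} (y α : Fin n → ℂ) (D₀ D₁ K₀ M₀ I : ℕ) (C : ℝ)
    (hI : (D₀ + 1) * (D₁ + 1) ≤ 2 ^ (I + 1) * (K₀ + 1))
    (hrep : ∀ i ≤ I, ∃ (S : Finset (ℕ × (Fin n → ℕ))) (c : ℕ × (Fin n → ℕ) → ℚ),
      (∀ km ∈ S, km.1 ≤ K₀ ∧ ∀ j, km.2 j ≤ M₀) ∧
      Represents y α D₀ D₁ S c (Polynomial.X ^ (2 ^ i * (K₀ + 1))) ∧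
      (∑ km ∈ S, |(c km : ℝ)|) ≤ C)
    (P : MvPolynomial (Fin 2) ℤ) (hP : P ≠ 0) (hP₀ : P.degreeOf 0 ≤ D₀) (hP₁ : P.degreeOf 1 ≤ D₁) :
    ∃ (S : Finset (ℕ × (Fin n → ℕ))) (c : ℕ × (Fin n → ℕ) → ℚ) (z : ℤ), z ≠ 0 ∧
      (∀ km ∈ S, km.1 ≤ (I + 2) * K₀ ∧ ∀ j, km.2 j ≤ (I + 1) * M₀) ∧
      (∑ km ∈ S, (c km : ℂ) * boxValue y α P km.1 km.2) = (z : ℂ) ∧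
      (∑ km ∈ S, |(c km : ℝ)|) ≤ max 1 C ^ (I + 1) := by
  sorry

end Summit.Schanuel.Schanuel.Cruxes.CheapCertificates.Sketch

end
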